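import Literature.MathematicalPhysics.QuantumLattice.Phi4InfiniteVolumeMMS
import Literature.MathematicalPhysics.QuantumFieldTheory.ContinuumLimitsTrivialityPrintedInputProofs
import HarnessLib

/-!
# The variance bounds (Aizenman–Duminil-Copin 2021, p. 6) for lattice `φ⁴`, and `phi44_triviality` from Prop. 7.2 alone

Proofs-only file (topic `Literature/MathematicalPhysics/QuantumFieldTheory`; theorems only, no
definition, no named fact). Sixth step of the `φ⁴` line of Aizenman–Duminil-Copin 2021 in the tree's
vocabulary. It **discharges outright the hypothesis `hvar` of
`phi44_triviality_of_prop72`** (`ContinuumLimitsTrivialityPrintedInputProofs`) — the two-sided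
variance bounds of ADC p. 6 (display after Prop. 1.4: "`C r_f² ‖f‖²_∞ ≥ ⟨T_{f,L}²⟩ ≥ c_f > 0`
uniformly in `β ≤ β_c` and `L`") for the free-boundary infinite-volume lattice `φ⁴` state on `ℤᵈ`,
`d ≥ 1`, in fact for **all** `J ≥ 0` — from the first Griffiths inequality, the
Messager–Miracle-Solé monotonicity (ADC (5.21), `Phi4InfiniteVolumeMMS`) and translation
invariance, without the infrared bound. Consequently (`phi44_triviality_of_prop72'`)
**`phi44_triviality` follows from ADC Prop. 7.2 alone** (the exponential-moment bound for the
free-boundary infinite-volume `φ⁴₄` state in the window `L ≤ ξ`).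

## Contents

1. Box sums of the infinite-volume two-point function `S(x,y) = ⨆_Λ ⟨φₓφ_y⟩_Λ`
   (`Phi4VolumeMonotonicity`): `χ_N = ∑_{‖z‖_∞ ≤ N} S(0,z)`, `A_N = ∑_{x,y ∈ Λ_N} S(x,y)` (written
   out, no definition); `A_N ≤ |Λ_N| χ_{2N}`, `A_N ≥ |Λ_{⌊N/2⌋}| χ_{⌊N/2⌋}`; the **doubling bound**
   `χ_{2N} ≤ (1 + (5d)ᵈ) χ_N` from (5.21) (`S(z) ≤ |Λ_{⌊N/d⌋}|⁻¹ χ_{⌊N/d⌋}` for `‖z‖_∞ > N`); the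
   **ratio bound** `A_{N'} ≤ C(ρ,d) A_N` for `N' ≤ ρ N`, `N ≥ 1`.
2. `⟨ψ₀²⟩ > 0` (`phi4_sq_moment_pos`) and `Σ_L = A_{⌊L⌋₊} > 0` (`phi4BlockVariance_eq`,
   `phi4BlockVariance_pos`): the block variance of ADC §1.2 exists as a box limit.
3. The box limit of `⟨T_{f,L}²⟩_{Λ_R}`: `v(J,L) = Σ_L⁻¹ ∑_{x,y} f(x/L) f(y/L) S(x,y)`
   (`hasBoxLimit_phi4NormalizedField_sq`).
4. **The variance bounds** `phi4_varianceBounds` in the exact shape of `hvar`, and the corollary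
   `phi44_triviality_of_prop72'`.

## References

* M. Aizenman, H. Duminil-Copin, Ann. of Math. 194 (2021), arXiv:1912.07973: p. 6 (display after
  Prop. 1.4), §1.2 (p. 4: `Σ_L`, `T_{f,L}`), (5.21) (p. 16), Prop. 7.2 (p. 28)
  [AizenmanDuminilCopinAnnals2021].
-/

noncomputable section

open scoped SchwartzMap NNReal
open MeasureTheory Filter Topology ProbabilityTheory Finset
open Literature.MathematicalPhysics.QuantumLattice (phi4Measure phi4FreeMeasure phi4BoxMeasure
  phi4CriticalJ phi4TwoPoint phi4TwoPointIn phi4Action siteToE siteToE_apply glueZero zdGraphIn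
  measurable_glueZero integrable_exp_neg_phi4Action phi4TwoPointIn_eq_of_mem
  phi4TwoPointIn_nonneg phi4TwoPointIn_le_iSup iSup_phi4TwoPointIn_nonneg hasBoxLimit_phi4TwoPointIn
  iSup_phi4TwoPointIn_shift iSup_phi4TwoPointIn_eq_zero_sub phi4_iSup_le_of_mul_supNorm_le
  phi4_iSup_le_iSup_zero integrable_pow_mul_pow_phi4Measure)
open Literature.Probability.LatticeModels (box mem_box card_box box_mono zero_mem_box latticeBox
  mem_latticeBox latticeBox_eq_box HasBoxLimit boxLim boxLim_eq_of_hasBoxLimit invCorrLength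
  Site.supNorm Site.natAbs_le_supNorm Site.supNorm_le_iff mem_box_iff_supNorm_le
  exists_cube_of_hasCompactSupport)
open Literature.Probability.LatticeModels renaming Site → LSite

namespace Literature.MathematicalPhysics.QuantumFieldTheory

variable {d : ℕ}

/-! ### 1. Box sums of the infinite-volume two-point function -/

section BoxSums

variable (d)

/-- The box susceptibilities `χ_N = ∑_{‖z‖_∞ ≤ N} S(0,z)` are nonnegative. [folklore] -/
theorem boxChi_nonneg {g : ℝ} (hg : 0 < g) (κ : ℝ) {J : ℝ} (hJ : 0 ≤ J) (N : ℕ) :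
    0 ≤ ∑ z ∈ box d N, ⨆ Λ : Finset (LSite d), phi4TwoPointIn d Λ g κ J 0 z :=
  Finset.sum_nonneg fun z _ => iSup_phi4TwoPointIn_nonneg d hg κ hJ 0 z

/-- `χ_N` is non-decreasing in `N`. [folklore] -/
theorem boxChi_mono {g : ℝ} (hg : 0 < g) (κ : ℝ) {J : ℝ} (hJ : 0 ≤ J) {N N' : ℕ} (h : N ≤ N') :
    ∑ z ∈ box d N, (⨆ Λ : Finset (LSite d), phi4TwoPointIn d Λ g κ J 0 z) ≤
      ∑ z ∈ box d N', ⨆ Λ : Finset (LSite d), phi4TwoPointIn d Λ g κ J 0 z :=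
  Finset.sum_le_sum_of_subset_of_nonneg (box_mono d h) fun z _ _ =>
    iSup_phi4TwoPointIn_nonneg d hg κ hJ 0 z

/-- `χ_N ≤ |Λ_N| S(0,0)` (each `S(0,z) ≤ S(0,0)` by (5.21)). [cite: AizenmanDuminilCopinAnnals2021, (5.21) (p. 16)] -/
theorem boxChi_le_card_mul (hd : 1 ≤ d) {g : ℝ} (hg : 0 < g) (κ : ℝ) {J : ℝ} (hJ : 0 ≤ J)
    (N : ℕ) :
    ∑ z ∈ box d N, (⨆ Λ : Finset (LSite d), phi4TwoPointIn d Λ g κ J 0 z) ≤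
      (box d N).card * ⨆ Λ : Finset (LSite d), phi4TwoPointIn d Λ g κ J 0 0 := by
  refine (Finset.sum_le_sum fun z _ => phi4_iSup_le_iSup_zero d hd hg κ hJ z).trans ?_
  rw [Finset.sum_const, nsmul_eq_mul]

/-- Adjacent differences of boxes lie in the doubled box: `y - x ∈ Λ_{2N}` for `x, y ∈ Λ_N`. [folklore] -/
theorem sub_mem_box_two_mul {N : ℕ} {x y : LSite d} (hx : x ∈ box d N) (hy : y ∈ box d N) :
    y - x ∈ box d (2 * N) := by
  rw [mem_box] at hx hy ⊢
  intro i
  have := hx i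
  have := hy i
  simp only [Pi.sub_apply]
  constructor <;> omega

/-- Sums of boxes: `x + z ∈ Λ_N` for `x, z ∈ Λ_{⌊N/2⌋}`. [folklore] -/
theorem add_mem_box_of_mem_box_div_two {N : ℕ} {x z : LSite d} (hx : x ∈ box d (N / 2))
    (hz : z ∈ box d (N / 2)) : x + z ∈ box d N := by
  rw [mem_box] at hx hz ⊢
  intro i
  have := hx i
  have := hz i
  simp only [Pi.add_apply]
  constructor <;> omega

/-- **`A_N ≤ |Λ_N| χ_{2N}`** (translation invariance `S(x,y) = S(0,y-x)` and `y - x ∈ Λ_{2N}`). [folklore] -/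
theorem boxPairSum_le {g : ℝ} (hg : 0 < g) (κ : ℝ) {J : ℝ} (hJ : 0 ≤ J) (N : ℕ) :
    ∑ x ∈ box d N, ∑ y ∈ box d N, (⨆ Λ : Finset (LSite d), phi4TwoPointIn d Λ g κ J x y) ≤
      (box d N).card * ∑ z ∈ box d (2 * N), ⨆ Λ : Finset (LSite d), phi4TwoPointIn d Λ g κ J 0 z := by
  have hrow : ∀ x ∈ box d N, ∑ y ∈ box d N, (⨆ Λ : Finset (LSite d), phi4TwoPointIn d Λ g κ J x y) ≤
      ∑ z ∈ box d (2 * N), ⨆ Λ : Finset (LSite d), phi4TwoPointIn d Λ g κ J 0 z := by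
    intro x hx
    simp_rw [iSup_phi4TwoPointIn_eq_zero_sub d g κ J x]
    rw [← Finset.sum_image (f := fun z => ⨆ Λ : Finset (LSite d), phi4TwoPointIn d Λ g κ J 0 z)
      (s := box d N) (g := fun y => y - x) (fun y _ y' _ h => sub_left_injective h)]
    refine Finset.sum_le_sum_of_subset_of_nonneg ?_ fun z _ _ => iSup_phi4TwoPointIn_nonneg d hg κ hJ 0 z
    intro z hz
    obtain ⟨y, hy, rfl⟩ := Finset.mem_image.1 hz
    exact sub_mem_box_two_mul d hx hy
  calc ∑ x ∈ box d N, ∑ y ∈ box d N, (⨆ Λ : Finset (LSite d), phi4TwoPointIn d Λ g κ J x y)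
      ≤ ∑ _x ∈ box d N, ∑ z ∈ box d (2 * N), ⨆ Λ : Finset (LSite d), phi4TwoPointIn d Λ g κ J 0 z :=
        Finset.sum_le_sum hrow
    _ = _ := by rw [Finset.sum_const, nsmul_eq_mul]

/-- **`A_N ≥ |Λ_{⌊N/2⌋}| χ_{⌊N/2⌋}`** (for `x ∈ Λ_{⌊N/2⌋}` the sites `x + z`, `z ∈ Λ_{⌊N/2⌋}`, lie in
`Λ_N`). [folklore] -/
theorem le_boxPairSum {g : ℝ} (hg : 0 < g) (κ : ℝ) {J : ℝ} (hJ : 0 ≤ J) (N : ℕ) :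
    ((box d (N / 2)).card : ℝ) * ∑ z ∈ box d (N / 2), (⨆ Λ : Finset (LSite d), phi4TwoPointIn d Λ g κ J 0 z) ≤
      ∑ x ∈ box d N, ∑ y ∈ box d N, ⨆ Λ : Finset (LSite d), phi4TwoPointIn d Λ g κ J x y := by
  have hnn : ∀ x y : LSite d, 0 ≤ ⨆ Λ : Finset (LSite d), phi4TwoPointIn d Λ g κ J x y :=
    fun x y => iSup_phi4TwoPointIn_nonneg d hg κ hJ x y
  have hrow : ∀ x ∈ box d (N / 2), ∑ z ∈ box d (N / 2), (⨆ Λ : Finset (LSite d), phi4TwoPointIn d Λ g κ J 0 z) ≤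
      ∑ y ∈ box d N, ⨆ Λ : Finset (LSite d), phi4TwoPointIn d Λ g κ J x y := by
    intro x hx
    have hre : ∑ z ∈ box d (N / 2), (⨆ Λ : Finset (LSite d), phi4TwoPointIn d Λ g κ J 0 z) =
        ∑ y ∈ (box d (N / 2)).image (fun z => x + z),
          ⨆ Λ : Finset (LSite d), phi4TwoPointIn d Λ g κ J x y := by
      rw [Finset.sum_image (fun z _ z' _ h => add_left_cancel h)]
      refine Finset.sum_congr rfl fun z _ => ?_
      have h := iSup_phi4TwoPointIn_shift d x g κ J 0 z
      rw [zero_add, add_comm z x] at h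
      exact h.symm
    rw [hre]
    refine Finset.sum_le_sum_of_subset_of_nonneg ?_ fun y _ _ => hnn x y
    intro y hy
    obtain ⟨z, hz, rfl⟩ := Finset.mem_image.1 hy
    exact add_mem_box_of_mem_box_div_two d hx hz
  calc ((box d (N / 2)).card : ℝ) * ∑ z ∈ box d (N / 2), (⨆ Λ : Finset (LSite d), phi4TwoPointIn d Λ g κ J 0 z)
      = ∑ _x ∈ box d (N / 2), ∑ z ∈ box d (N / 2), ⨆ Λ : Finset (LSite d), phi4TwoPointIn d Λ g κ J 0 z := by
        rw [Finset.sum_const, nsmul_eq_mul]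
    _ ≤ ∑ x ∈ box d (N / 2), ∑ y ∈ box d N, ⨆ Λ : Finset (LSite d), phi4TwoPointIn d Λ g κ J x y :=
        Finset.sum_le_sum hrow
    _ ≤ _ := Finset.sum_le_sum_of_subset_of_nonneg (box_mono d (Nat.div_le_self N 2))
        fun x _ _ => Finset.sum_nonneg fun y _ => hnn x y

/-- The counting bound behind the doubling: `|Λ_{2N}| ≤ (5d)ᵈ |Λ_{⌊N/d⌋}|` (`d ≥ 1`). [folklore] -/
theorem card_box_two_mul_le (hd : 1 ≤ d) (N : ℕ) :
    ((box d (2 * N)).card : ℝ) ≤ (5 * d : ℝ) ^ d * (box d (N / d)).card := by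
  rw [card_box, card_box]
  push_cast
  rw [← mul_pow]
  refine pow_le_pow_left₀ (by positivity) ?_ d
  have hdpos : 0 < d := hd
  have h1 : N < N / d * d + d := Nat.lt_div_mul_add hdpos
  have h2 : (N : ℝ) + 1 ≤ (N / d : ℕ) * d + d := by exact_mod_cast h1
  have h3 : (1 : ℝ) ≤ d := by exact_mod_cast hd
  nlinarith [h2, h3, (Nat.cast_nonneg (N / d) : (0 : ℝ) ≤ (N / d : ℕ))]

/-- **The doubling bound** `χ_{2N} ≤ (1 + (5d)ᵈ) χ_N` for the free-boundary lattice `φ⁴` model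
(`d ≥ 1`, `g > 0`, `J ≥ 0`): every `z ∈ Λ_{2N} ∖ Λ_N` has `‖z‖_∞ > N ≥ d ‖x‖_∞` for all
`x ∈ Λ_{⌊N/d⌋}`, so by (5.21) `S(0,z) ≤ |Λ_{⌊N/d⌋}|⁻¹ χ_{⌊N/d⌋} ≤ |Λ_{⌊N/d⌋}|⁻¹ χ_N`, and there
are at most `|Λ_{2N}| ≤ (5d)ᵈ |Λ_{⌊N/d⌋}|` such `z`. [cite: AizenmanDuminilCopinAnnals2021, (5.21) (p. 16)] -/
theorem boxChi_two_mul_le (hd : 1 ≤ d) {g : ℝ} (hg : 0 < g) (κ : ℝ) {J : ℝ} (hJ : 0 ≤ J) (N : ℕ) :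
    ∑ z ∈ box d (2 * N), (⨆ Λ : Finset (LSite d), phi4TwoPointIn d Λ g κ J 0 z) ≤
      (1 + (5 * d : ℝ) ^ d) * ∑ z ∈ box d N, ⨆ Λ : Finset (LSite d), phi4TwoPointIn d Λ g κ J 0 z := by
  set S : LSite d → ℝ := fun z => ⨆ Λ : Finset (LSite d), phi4TwoPointIn d Λ g κ J 0 z with hS
  set q : ℕ := N / d with hq
  have hSnn : ∀ z, 0 ≤ S z := fun z => iSup_phi4TwoPointIn_nonneg d hg κ hJ 0 z
  have hcardq : (0 : ℝ) < (box d q).card := by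
    exact_mod_cast Finset.card_pos.2 ⟨0, zero_mem_box d q⟩
  -- `S z ≤ χ_q / |Λ_q|` off `Λ_N`
  have hfar : ∀ z, z ∉ box d N → S z ≤ (∑ x ∈ box d q, S x) / (box d q).card := by
    intro z hz
    rw [le_div_iff₀ hcardq, mul_comm]
    calc ((box d q).card : ℝ) * S z = ∑ _x ∈ box d q, S z := by rw [Finset.sum_const, nsmul_eq_mul]
      _ ≤ ∑ x ∈ box d q, S x := Finset.sum_le_sum fun x hx => by
          refine phi4_iSup_le_of_mul_supNorm_le d hd hg κ hJ ?_
          rw [mem_box_iff_supNorm_le] at hx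
          rw [mem_box_iff_supNorm_le, not_le] at hz
          calc d * Site.supNorm x ≤ d * q := Nat.mul_le_mul_left d hx
            _ ≤ N := Nat.mul_div_le N d
            _ ≤ Site.supNorm z := hz.le
  -- split `Λ_{2N} = Λ_N ⊔ (Λ_{2N} ∖ Λ_N)`
  have hsub : box d N ⊆ box d (2 * N) := box_mono d (by omega)
  rw [← Finset.sum_sdiff hsub, add_comm, add_mul, one_mul]
  refine add_le_add le_rfl ?_
  calc ∑ z ∈ box d (2 * N) \ box d N, S z
      ≤ ∑ _z ∈ box d (2 * N) \ box d N, (∑ x ∈ box d q, S x) / (box d q).card :=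
        Finset.sum_le_sum fun z hz => hfar z (Finset.mem_sdiff.1 hz).2
    _ = ((box d (2 * N) \ box d N).card : ℝ) * ((∑ x ∈ box d q, S x) / (box d q).card) := by
        rw [Finset.sum_const, nsmul_eq_mul]
    _ ≤ ((box d (2 * N)).card : ℝ) * ((∑ x ∈ box d N, S x) / (box d q).card) := by
        refine mul_le_mul ?_ ?_ (div_nonneg (Finset.sum_nonneg fun x _ => hSnn x) hcardq.le)
          (Nat.cast_nonneg _)
        · exact_mod_cast Finset.card_le_card Finset.sdiff_subset
        · exact div_le_div_of_nonneg_right (boxChi_mono d hg κ hJ (Nat.div_le_self N d)) hcardq.le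
    _ ≤ (5 * d : ℝ) ^ d * (box d q).card * ((∑ x ∈ box d N, S x) / (box d q).card) :=
        mul_le_mul_of_nonneg_right (card_box_two_mul_le d hd N)
          (div_nonneg (Finset.sum_nonneg fun x _ => hSnn x) hcardq.le)
    _ = (5 * d : ℝ) ^ d * ∑ z ∈ box d N, S z := by
        field_simp

/-- Iterated doubling: `χ_{2^k N} ≤ (1 + (5d)ᵈ)^k χ_N`. [folklore] -/
theorem boxChi_pow_two_mul_le (hd : 1 ≤ d) {g : ℝ} (hg : 0 < g) (κ : ℝ) {J : ℝ} (hJ : 0 ≤ J)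
    (k N : ℕ) :
    ∑ z ∈ box d (2 ^ k * N), (⨆ Λ : Finset (LSite d), phi4TwoPointIn d Λ g κ J 0 z) ≤
      (1 + (5 * d : ℝ) ^ d) ^ k * ∑ z ∈ box d N, ⨆ Λ : Finset (LSite d), phi4TwoPointIn d Λ g κ J 0 z := by
  induction k with
  | zero => simp
  | succ k ih =>
      rw [pow_succ, mul_comm (2 ^ k) 2, mul_assoc, pow_succ, mul_comm ((1 + (5 * d : ℝ) ^ d) ^ k),
        mul_assoc]
      refine (boxChi_two_mul_le d hd hg κ hJ (2 ^ k * N)).trans ?_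
      exact mul_le_mul_of_nonneg_left ih (by positivity)

/-- **The ratio bound for the box pair sums**: for `ρ ≥ 1` there is `C = C(ρ, d) > 0` with
`A_{N'} ≤ C A_N` whenever `N ≥ 1` and `N' ≤ ρ N` (`d ≥ 1`, `g > 0`, `J ≥ 0`; uniform in `g, κ, J`).
[folklore] -/
theorem boxPairSum_ratio_le (hd : 1 ≤ d) {ρ : ℝ} (hρ : 1 ≤ ρ) :
    ∃ C : ℝ, 0 < C ∧ ∀ {g : ℝ}, 0 < g → ∀ (κ : ℝ) {J : ℝ}, 0 ≤ J → ∀ N N' : ℕ, 1 ≤ N →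
      (N' : ℝ) ≤ ρ * N →
      ∑ x ∈ box d N', ∑ y ∈ box d N', (⨆ Λ : Finset (LSite d), phi4TwoPointIn d Λ g κ J x y) ≤
        C * ∑ x ∈ box d N, ∑ y ∈ box d N, ⨆ Λ : Finset (LSite d), phi4TwoPointIn d Λ g κ J x y := by
  set K : ℝ := 1 + (5 * d : ℝ) ^ d with hK
  have hK1 : 1 ≤ K := le_add_of_nonneg_right (by positivity)
  set k : ℕ := ⌈6 * ρ⌉₊ with hk
  have hk6 : 6 * ρ ≤ (2 : ℝ) ^ k := by
    calc 6 * ρ ≤ k := Nat.le_ceil _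
      _ ≤ (2 : ℝ) ^ k := by exact_mod_cast (Nat.lt_two_pow_self).le
  set C₁ : ℝ := K ^ k + (4 * ρ + 1) ^ d with hC₁
  set C : ℝ := (2 * ρ + 1) ^ d * C₁ with hC
  have hC₁pos : 0 < C₁ := by positivity
  refine ⟨C, by positivity, fun {g} hg κ {J} hJ N N' hN hN' => ?_⟩
  set S : LSite d → ℝ := fun z => ⨆ Λ : Finset (LSite d), phi4TwoPointIn d Λ g κ J 0 z with hS
  set M : ℕ := N / 2 with hM
  have hSnn : ∀ z, 0 ≤ S z := fun z => iSup_phi4TwoPointIn_nonneg d hg κ hJ 0 z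
  have hchi_nn : ∀ n : ℕ, 0 ≤ ∑ z ∈ box d n, S z := fun n => Finset.sum_nonneg fun z _ => hSnn z
  have hNM : (N : ℝ) ≤ 2 * M + 1 := by
    have : N ≤ 2 * (N / 2) + 1 := by omega
    exact_mod_cast this
  -- (i) cardinalities
  have hcard : ((box d N').card : ℝ) ≤ (2 * ρ + 1) ^ d * (box d M).card := by
    rw [card_box, card_box]
    push_cast
    rw [← mul_pow]
    refine pow_le_pow_left₀ (by positivity) ?_ d
    nlinarith [hN', hNM, hρ, (Nat.cast_nonneg M : (0 : ℝ) ≤ M)]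
  -- (ii) `χ_{2N'} ≤ C₁ χ_M`
  have hchi : ∑ z ∈ box d (2 * N'), S z ≤ C₁ * ∑ z ∈ box d M, S z := by
    rcases Nat.eq_zero_or_pos M with hM0 | hMpos
    · -- `N = 1`, `N' ≤ ρ`: bound by `|Λ_{2N'}| S(0,0) ≤ (4ρ+1)^d χ_0`
      have hN1 : N = 1 := by omega
      have hchi0 : ∑ z ∈ box d M, S z = S 0 := by
        rw [hM0]
        have : box d 0 = {0} := by
          ext z
          rw [mem_box_iff_supNorm_le, Nat.le_zero,
            Literature.Probability.LatticeModels.Site.supNorm_eq_zero_iff, Finset.mem_singleton]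
        rw [this, Finset.sum_singleton]
      rw [hchi0]
      calc ∑ z ∈ box d (2 * N'), S z ≤ (box d (2 * N')).card * S 0 :=
            boxChi_le_card_mul d hd hg κ hJ (2 * N')
        _ ≤ (4 * ρ + 1) ^ d * S 0 := by
            refine mul_le_mul_of_nonneg_right ?_ (hSnn 0)
            rw [card_box]
            push_cast
            refine pow_le_pow_left₀ (by positivity) ?_ d
            rw [hN1] at hN'
            push_cast at hN'
            linarith
        _ ≤ C₁ * S 0 := by
            refine mul_le_mul_of_nonneg_right ?_ (hSnn 0)
            rw [hC₁]
            have : (0 : ℝ) ≤ K ^ k := by positivity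
            linarith
    · -- `M ≥ 1`: `2N' ≤ 2^k M` and iterate the doubling
      have hle : 2 * N' ≤ 2 ^ k * M := by
        have h1 : (2 * N' : ℝ) ≤ 6 * ρ * M := by
          have hM1 : (1 : ℝ) ≤ M := by exact_mod_cast hMpos
          nlinarith [hN', hNM, hρ]
        have h2 : (6 * ρ * M : ℝ) ≤ (2 : ℝ) ^ k * M :=
          mul_le_mul_of_nonneg_right hk6 (Nat.cast_nonneg M)
        exact_mod_cast h1.trans h2
      calc ∑ z ∈ box d (2 * N'), S z ≤ ∑ z ∈ box d (2 ^ k * M), S z := boxChi_mono d hg κ hJ hle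
        _ ≤ K ^ k * ∑ z ∈ box d M, S z := boxChi_pow_two_mul_le d hd hg κ hJ k M
        _ ≤ C₁ * ∑ z ∈ box d M, S z := by
            refine mul_le_mul_of_nonneg_right ?_ (hchi_nn M)
            rw [hC₁]
            have : (0 : ℝ) ≤ (4 * ρ + 1) ^ d := by positivity
            linarith
  -- assemble
  calc ∑ x ∈ box d N', ∑ y ∈ box d N', (⨆ Λ : Finset (LSite d), phi4TwoPointIn d Λ g κ J x y)
      ≤ (box d N').card * ∑ z ∈ box d (2 * N'), S z := boxPairSum_le d hg κ hJ N'
    _ ≤ ((2 * ρ + 1) ^ d * (box d M).card) * (C₁ * ∑ z ∈ box d M, S z) :=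
        mul_le_mul hcard hchi (hchi_nn _) (by positivity)
    _ = C * ((box d M).card * ∑ z ∈ box d M, S z) := by rw [hC]; ring
    _ ≤ C * ∑ x ∈ box d N, ∑ y ∈ box d N, ⨆ Λ : Finset (LSite d), phi4TwoPointIn d Λ g κ J x y :=
        mul_le_mul_of_nonneg_left (le_boxPairSum d hg κ hJ N) (by positivity)

end BoxSums

/-! ### 2. Positivity: `⟨ψ²⟩ > 0`, `S(x,x) > 0`, `Σ_L > 0` -/

section Positivity

variable {V : Type*} [Fintype V] (G : SimpleGraph V) [DecidableRel G.Adj]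

/-- The second moment of any coordinate under the lattice `φ⁴` measure is positive (the measure is
equivalent to Lebesgue measure, which charges `{ψ_a ≠ 0}`). [folklore] -/
theorem phi4_sq_moment_pos {g : ℝ} (hg : 0 < g) (κ J : ℝ) (a : V) :
    0 < ∫ ψ, ψ a ^ 2 ∂(phi4Measure G g κ J) := by
  classical
  have hint : Integrable (fun ψ : V → ℝ => ψ a ^ 2) (phi4Measure G g κ J) := by
    simpa using integrable_pow_mul_pow_phi4Measure G hg κ J a a 2 0
  rw [integral_pos_iff_support_of_nonneg (f := fun ψ : V → ℝ => ψ a ^ 2) (fun ψ => sq_nonneg (ψ a)) hint]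
  have hsupp : Function.support (fun ψ : V → ℝ => ψ a ^ 2) = {ψ | ψ a ≠ 0} := by
    ext ψ
    simp
  rw [hsupp]
  by_contra h0
  have h0' : phi4Measure G g κ J {ψ : V → ℝ | ψ a ≠ 0} = 0 := le_antisymm (not_lt.1 h0) bot_le
  have hac : (volume : Measure (V → ℝ)) ≪ phi4Measure G g κ J := by
    change _ ≪ (volume : Measure (V → ℝ)).tilted fun φ => -phi4Action G g κ J φ
    exact absolutelyContinuous_tilted (integrable_exp_neg_phi4Action G hg κ J)
  have hvol : (volume : Measure (V → ℝ)) {ψ | ψ a ≠ 0} = 0 := hac h0'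
  have hcube : (volume : Measure (V → ℝ)) (Set.pi Set.univ fun _ : V => Set.Ioo (0 : ℝ) 1) ≤
      volume {ψ : V → ℝ | ψ a ≠ 0} :=
    measure_mono fun ψ hψ => ne_of_gt ((Set.mem_univ_pi.1 hψ a).1)
  rw [hvol, Real.volume_pi_Ioo] at hcube
  simp at hcube

end Positivity

section BlockVariance

variable (d)

/-- `S(x,x) = ⨆_Λ ⟨φₓ²⟩_Λ > 0`. [folklore] -/
theorem iSup_phi4TwoPointIn_self_pos {g : ℝ} (hg : 0 < g) (κ : ℝ) {J : ℝ} (hJ : 0 ≤ J)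
    (x : LSite d) : 0 < ⨆ Λ : Finset (LSite d), phi4TwoPointIn d Λ g κ J x x := by
  classical
  have hx : x ∈ ({x} : Finset (LSite d)) := Finset.mem_singleton_self x
  refine lt_of_lt_of_le ?_ (phi4TwoPointIn_le_iSup d {x} hg κ hJ x x)
  rw [phi4TwoPointIn_eq_of_mem d {x} g κ J hx hx]
  have h := phi4_sq_moment_pos (zdGraphIn d {x}) hg κ J ⟨x, hx⟩
  simpa only [sq] using h

/-- Products of two coordinates are integrable under the free-boundary `φ⁴` measures. [folklore] -/
theorem integrable_mul_phi4FreeMeasure (Λ : Finset (LSite d)) {g : ℝ} (hg : 0 < g) (κ J : ℝ)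
    (x y : LSite d) :
    Integrable (fun φ : LSite d → ℝ => φ x * φ y) (phi4FreeMeasure d Λ g κ J) := by
  classical
  haveI := Literature.MathematicalPhysics.QuantumLattice.isProbabilityMeasure_phi4Measure_holds
    (zdGraphIn d Λ) hg κ J
  unfold phi4FreeMeasure
  have hmeas : Measurable fun φ : LSite d → ℝ => φ x * φ y :=
    (measurable_pi_apply x).mul (measurable_pi_apply y)
  refine (integrable_map_measure hmeas.aestronglyMeasurable (measurable_glueZero Λ).aemeasurable).2 ?_
  by_cases hx : x ∈ Λ
  · by_cases hy : y ∈ Λ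
    · have : ((fun φ : LSite d → ℝ => φ x * φ y) ∘ glueZero Λ) =
          fun ψ => ψ ⟨x, hx⟩ * ψ ⟨y, hy⟩ := by
        funext ψ; simp [hx, hy]
      rw [this]
      simpa using integrable_pow_mul_pow_phi4Measure (zdGraphIn d Λ) hg κ J ⟨x, hx⟩ ⟨y, hy⟩ 1 1
    · have : ((fun φ : LSite d → ℝ => φ x * φ y) ∘ glueZero Λ) = fun _ => 0 := by
        funext ψ; simp [hy]
      rw [this]
      exact integrable_const _
  · have : ((fun φ : LSite d → ℝ => φ x * φ y) ∘ glueZero Λ) = fun _ => 0 := by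
      funext ψ; simp [hx]
    rw [this]
    exact integrable_const _

/-- `∫ φₓ φ_y dμ_Λ = ⟨φₓ φ_y⟩_Λ` (`phi4TwoPointIn` unfolded). [folklore] -/
theorem integral_mul_phi4FreeMeasure (Λ : Finset (LSite d)) (g κ J : ℝ) (x y : LSite d) :
    ∫ φ, φ x * φ y ∂(phi4FreeMeasure d Λ g κ J) = phi4TwoPointIn d Λ g κ J x y := rfl

/-- **Second moments of lattice sums are double sums of two-point functions**:
`⟨(∑_{x∈B} aₓ φₓ)²⟩_Λ = ∑_{x,y ∈ B} aₓ a_y ⟨φₓ φ_y⟩_Λ`. [folklore] -/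
theorem integral_sq_sum_phi4FreeMeasure (Λ : Finset (LSite d)) {g : ℝ} (hg : 0 < g) (κ J : ℝ)
    (B : Finset (LSite d)) (a : LSite d → ℝ) :
    ∫ φ, (∑ x ∈ B, a x * φ x) ^ 2 ∂(phi4FreeMeasure d Λ g κ J) =
      ∑ x ∈ B, ∑ y ∈ B, a x * a y * phi4TwoPointIn d Λ g κ J x y := by
  have hI : ∀ x y, Integrable (fun φ : LSite d → ℝ => a x * a y * (φ x * φ y))
      (phi4FreeMeasure d Λ g κ J) := fun x y =>
    (integrable_mul_phi4FreeMeasure d Λ hg κ J x y).const_mul _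
  have hfun : (fun φ : LSite d → ℝ => (∑ x ∈ B, a x * φ x) ^ 2) =
      fun φ => ∑ x ∈ B, ∑ y ∈ B, a x * a y * (φ x * φ y) := by
    funext φ
    rw [sq, Finset.sum_mul_sum]
    refine Finset.sum_congr rfl fun x _ => Finset.sum_congr rfl fun y _ => ?_
    ring
  rw [hfun, integral_finsetSum _ fun x _ => integrable_finsetSum _ fun y _ => hI x y]
  refine Finset.sum_congr rfl fun x _ => ?_
  rw [integral_finsetSum _ fun y _ => hI x y]
  refine Finset.sum_congr rfl fun y _ => ?_
  rw [integral_const_mul, integral_mul_phi4FreeMeasure]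

/-- **Box limit of the second moment of a lattice sum**: `⟨(∑_{x∈B} aₓ φₓ)²⟩_{Λ_R} →
∑_{x,y∈B} aₓ a_y S(x,y)` as `R → ∞`. [cite: AizenmanDuminilCopinAnnals2021, §1.2 (p. 4: Σ_L for the infinite-volume state)] -/
theorem hasBoxLimit_phi4BoxExpect_sq_sum {g : ℝ} (hg : 0 < g) (κ : ℝ) {J : ℝ} (hJ : 0 ≤ J)
    (B : Finset (LSite d)) (a : LSite d → ℝ) :
    HasBoxLimit (phi4BoxExpect d g κ J fun φ => (∑ x ∈ B, a x * φ x) ^ 2)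
      (∑ x ∈ B, ∑ y ∈ B, a x * a y * ⨆ Λ : Finset (LSite d), phi4TwoPointIn d Λ g κ J x y) := by
  unfold HasBoxLimit phi4BoxExpect
  simp_rw [integral_sq_sum_phi4FreeMeasure d _ hg κ J B a]
  refine tendsto_finsetSum _ fun x _ => tendsto_finsetSum _ fun y _ => ?_
  exact (hasBoxLimit_phi4TwoPointIn d hg κ hJ x y).const_mul _

/-- **The block variance `Σ_L` exists as a box limit and is the double box sum of the
infinite-volume two-point function**: `Σ_L = ∑_{x,y ∈ Λ_L} S(x,y)` (`g > 0`, `J ≥ 0`). [cite: AizenmanDuminilCopinAnnals2021, §1.2 (p. 4), Def. 1.1] -/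
theorem phi4BlockVariance_eq {g : ℝ} (hg : 0 < g) (κ : ℝ) {J : ℝ} (hJ : 0 ≤ J) (L : ℝ) :
    phi4BlockVariance d g κ J L = ∑ x ∈ latticeBox d L, ∑ y ∈ latticeBox d L,
      ⨆ Λ : Finset (LSite d), phi4TwoPointIn d Λ g κ J x y := by
  unfold phi4BlockVariance
  have hfun : (fun φ : LSite d → ℝ => (∑ x ∈ latticeBox d L, φ x) ^ 2) =
      fun φ => (∑ x ∈ latticeBox d L, (1 : ℝ) * φ x) ^ 2 := by
    simp only [one_mul]
  rw [hfun]
  refine boxLim_eq_of_hasBoxLimit ?_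
  have h := hasBoxLimit_phi4BoxExpect_sq_sum d hg κ hJ (latticeBox d L) (fun _ => 1)
  simpa only [one_mul] using h

/-- **`Σ_L > 0`** for `L ≥ 0` (it contains the term `S(0,0) > 0`, all terms being nonnegative). [folklore] -/
theorem phi4BlockVariance_pos {g : ℝ} (hg : 0 < g) (κ : ℝ) {J : ℝ} (hJ : 0 ≤ J) {L : ℝ}
    (hL : 0 ≤ L) : 0 < phi4BlockVariance d g κ J L := by
  rw [phi4BlockVariance_eq d hg κ hJ L]
  have h0 : (0 : LSite d) ∈ latticeBox d L := by
    rw [mem_latticeBox]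
    intro i
    simpa using hL
  have hnn : ∀ x y : LSite d, 0 ≤ ⨆ Λ : Finset (LSite d), phi4TwoPointIn d Λ g κ J x y :=
    fun x y => iSup_phi4TwoPointIn_nonneg d hg κ hJ x y
  calc (0 : ℝ) < ⨆ Λ : Finset (LSite d), phi4TwoPointIn d Λ g κ J 0 0 :=
        iSup_phi4TwoPointIn_self_pos d hg κ hJ 0
    _ ≤ ∑ y ∈ latticeBox d L, ⨆ Λ : Finset (LSite d), phi4TwoPointIn d Λ g κ J 0 y :=
        Finset.single_le_sum (f := fun y => ⨆ Λ : Finset (LSite d), phi4TwoPointIn d Λ g κ J 0 y)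
          (fun y _ => hnn 0 y) h0
    _ ≤ ∑ x ∈ latticeBox d L, ∑ y ∈ latticeBox d L,
          ⨆ Λ : Finset (LSite d), phi4TwoPointIn d Λ g κ J x y :=
        Finset.single_le_sum (f := fun x => ∑ y ∈ latticeBox d L,
          ⨆ Λ : Finset (LSite d), phi4TwoPointIn d Λ g κ J x y)
          (fun x _ => Finset.sum_nonneg fun y _ => hnn x y) h0

/-- For `L ≥ 0`, `Σ_L = A_{⌊L⌋₊}`. [folklore] -/
theorem phi4BlockVariance_eq_boxPairSum {g : ℝ} (hg : 0 < g) (κ : ℝ) {J : ℝ} (hJ : 0 ≤ J) {L : ℝ}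
    (hL : 0 ≤ L) :
    phi4BlockVariance d g κ J L = ∑ x ∈ box d ⌊L⌋₊, ∑ y ∈ box d ⌊L⌋₊,
      ⨆ Λ : Finset (LSite d), phi4TwoPointIn d Λ g κ J x y := by
  rw [phi4BlockVariance_eq d hg κ hJ L, latticeBox_eq_box hL]

end BlockVariance

/-! ### 3. The box limit of `⟨T_{f,L}²⟩` -/

section NormalizedField

variable (d)

/-- **`⟨T_{f,L}²⟩_Λ` as a double sum**: for `L ≠ 0` and `f` vanishing outside `[-r,r]ᵈ`,
`⟨T_{f,L}²⟩_Λ = Σ_L^{-1} ∑_{x,y ∈ Λ_{rL}} f(x/L) f(y/L) ⟨φₓφ_y⟩_Λ` (with the tree's junk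
conventions for `Σ_L^{-1/2}`). [cite: AizenmanDuminilCopinAnnals2021, §1.2 (p. 4)] -/
theorem phi4BoxExpect_normalizedField_sq {g : ℝ} (hg : 0 < g) (κ J : ℝ) {L r : ℝ} (hL : L ≠ 0)
    {f : EuclideanSpace ℝ (Fin d) → ℝ} (hf : ∀ x, f x ≠ 0 → ∀ i, |x i| ≤ r)
    (Λ : Finset (LSite d)) :
    phi4BoxExpect d g κ J (fun φ => phi4NormalizedField d g κ J L f φ ^ 2) Λ =
      (Real.sqrt (phi4BlockVariance d g κ J L))⁻¹ ^ 2 *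
        ∑ x ∈ latticeBox d (r / |L⁻¹|), ∑ y ∈ latticeBox d (r / |L⁻¹|),
          f (L⁻¹ • siteToE x) * f (L⁻¹ • siteToE y) * phi4TwoPointIn d Λ g κ J x y := by
  unfold phi4BoxExpect
  simp_rw [phi4NormalizedField_eq_sum hL hf, mul_pow]
  rw [integral_const_mul, integral_sq_sum_phi4FreeMeasure d Λ hg κ J]

/-- **The box limit of `⟨T_{f,L}²⟩`**: `⟨T_{f,L}²⟩_{Λ_R} → v(J,L) = Σ_L^{-1} ∑_{x,y} f(x/L) f(y/L) S(x,y)`.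
[cite: AizenmanDuminilCopinAnnals2021, §1.2 (p. 4) and p. 6] -/
theorem hasBoxLimit_phi4NormalizedField_sq {g : ℝ} (hg : 0 < g) (κ : ℝ) {J : ℝ} (hJ : 0 ≤ J)
    {L r : ℝ} (hL : L ≠ 0) {f : EuclideanSpace ℝ (Fin d) → ℝ} (hf : ∀ x, f x ≠ 0 → ∀ i, |x i| ≤ r) :
    HasBoxLimit (phi4BoxExpect d g κ J fun φ => phi4NormalizedField d g κ J L f φ ^ 2)
      ((Real.sqrt (phi4BlockVariance d g κ J L))⁻¹ ^ 2 *
        ∑ x ∈ latticeBox d (r / |L⁻¹|), ∑ y ∈ latticeBox d (r / |L⁻¹|),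
          f (L⁻¹ • siteToE x) * f (L⁻¹ • siteToE y) *
            ⨆ Λ : Finset (LSite d), phi4TwoPointIn d Λ g κ J x y) := by
  have h := (hasBoxLimit_phi4BoxExpect_sq_sum d hg κ hJ (latticeBox d (r / |L⁻¹|))
    (fun x => f (L⁻¹ • siteToE x))).const_mul ((Real.sqrt (phi4BlockVariance d g κ J L))⁻¹ ^ 2)
  unfold HasBoxLimit at h ⊢
  refine h.congr fun R => ?_
  rw [phi4BoxExpect_normalizedField_sq d hg κ J hL hf]
  unfold phi4BoxExpect
  rw [integral_sq_sum_phi4FreeMeasure d _ hg κ J]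

end NormalizedField

/-! ### 4. The variance bounds and `phi44_triviality` from Prop. 7.2 alone -/

section VarianceBounds

variable (d)

/-- Elementary: a continuous function positive at `x₀` exceeds half its value on a ball. [folklore] -/
theorem exists_ball_gt_half {f : EuclideanSpace ℝ (Fin d) → ℝ} (hf : Continuous f)
    {x₀ : EuclideanSpace ℝ (Fin d)} (hx₀ : 0 < f x₀) :
    ∃ δ : ℝ, 0 < δ ∧ ∀ z, dist z x₀ < δ → f x₀ / 2 < f z := by
  obtain ⟨δ, hδ, h⟩ := Metric.continuousAt_iff.1 (hf.continuousAt (x := x₀)) (f x₀ / 2)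
    (by linarith)
  refine ⟨δ, hδ, fun z hz => ?_⟩
  have h1 := h hz
  rw [Real.dist_eq] at h1
  have h2 := (abs_lt.1 h1).1
  linarith

/-- Lattice approximation of a point: for `L > 0`, `c = ⌊L x₀⌋` and `z ∈ Λ_M`,
`dist((c + z)/L, x₀) ≤ d (M + 1) / L`. [folklore] -/
theorem dist_latticePoint_le {L : ℝ} (hL : 0 < L) (x₀ : EuclideanSpace ℝ (Fin d)) {M : ℕ}
    {z : LSite d} (hz : z ∈ box d M) :
    dist (L⁻¹ • siteToE ((fun i => ⌊L * x₀ i⌋) + z)) x₀ ≤ d * (M + 1) / L := by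
  have hcoord : ∀ i, dist ((L⁻¹ • siteToE ((fun i => ⌊L * x₀ i⌋) + z)) i) (x₀ i) ≤ (M + 1) / L := by
    intro i
    rw [PiLp.smul_apply, siteToE_apply, smul_eq_mul, Real.dist_eq, Pi.add_apply]
    push_cast
    have h1 : (⌊L * x₀ i⌋ : ℝ) ≤ L * x₀ i := Int.floor_le _
    have h2 : L * x₀ i < ⌊L * x₀ i⌋ + 1 := Int.lt_floor_add_one _
    have hz' : |(z i : ℝ)| ≤ M := by
      rw [mem_box] at hz
      have := hz i
      rw [abs_le]
      constructor <;> exact_mod_cast (by omega : _)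
    have key : L⁻¹ * ((⌊L * x₀ i⌋ : ℝ) + z i) - x₀ i =
        ((⌊L * x₀ i⌋ : ℝ) - L * x₀ i + z i) / L := by
      field_simp
      ring
    rw [key, abs_div, abs_of_pos hL]
    refine div_le_div_of_nonneg_right ?_ hL.le
    calc |(⌊L * x₀ i⌋ : ℝ) - L * x₀ i + z i| ≤ |(⌊L * x₀ i⌋ : ℝ) - L * x₀ i| + |(z i : ℝ)| :=
          abs_add_le _ _
      _ ≤ 1 + M := add_le_add (by rw [abs_le]; constructor <;> linarith) hz'
      _ = M + 1 := add_comm _ _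
  rw [EuclideanSpace.dist_eq]
  have hsum : ∑ i, dist ((L⁻¹ • siteToE ((fun i => ⌊L * x₀ i⌋) + z)) i) (x₀ i) ^ 2 ≤
      ∑ _i : Fin d, ((M + 1) / L) ^ 2 :=
    Finset.sum_le_sum fun i _ => pow_le_pow_left₀ dist_nonneg (hcoord i) 2
  rw [Finset.sum_const, Finset.card_univ, Fintype.card_fin, nsmul_eq_mul] at hsum
  have hML : 0 ≤ (M + 1) / L := by positivity
  calc Real.sqrt (∑ i, dist ((L⁻¹ • siteToE ((fun i => ⌊L * x₀ i⌋) + z)) i) (x₀ i) ^ 2)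
      ≤ Real.sqrt (d * ((M + 1) / L) ^ 2) := Real.sqrt_le_sqrt hsum
    _ ≤ d * ((M + 1) / L) := by
        rw [Real.sqrt_le_left (by positivity)]
        have hd1 : (d : ℝ) ≤ (d : ℝ) ^ 2 := by
          rcases Nat.eq_zero_or_pos d with h | h
          · simp [h]
          · have : (1 : ℝ) ≤ d := by exact_mod_cast h
            nlinarith
        nlinarith [sq_nonneg ((M + 1) / L)]
    _ = d * (M + 1) / L := by ring

/-- **The variance bounds of Aizenman–Duminil-Copin 2021, p. 6, for the free-boundary lattice
`φ⁴` model on `ℤᵈ`** (`d ≥ 1`, `g > 0`), in the exact shape of the hypothesis `hvar` of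
`phi44_triviality_of_prop72`: for every continuous compactly supported `f` there is `C_f` with
`⟨T_{f,L}²⟩ ≤ C_f` for all `J ≥ 0`, `L ≥ 1`, and for `f ≥ 0`, `f ≢ 0` there are `c_f > 0`, `L₀`
with `⟨T_{f,L}²⟩ ≥ c_f` for all `J ≥ 0`, `L ≥ L₀` — here `⟨T_{f,L}²⟩` is the (existing) box limit
of the free-boundary expectations. *Proof:* `⟨T_{f,L}²⟩ = Σ_L⁻¹ ∑_{x,y} f(x/L)f(y/L) S(x,y)` with
`S ≥ 0` (Griffiths) and `Σ_L = A_{⌊L⌋₊} > 0`; the upper bound is `‖f‖²_∞ A_{⌊rL⌋₊} / A_{⌊L⌋₊}`,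
the lower bound `(f(x₀)/2)² A_M / A_{⌊L⌋₊}` with `Λ_M + ⌊Lx₀⌋` inside `{f(·/L) > f(x₀)/2}`
(translation invariance), and both ratios are controlled by the ratio bound
`boxPairSum_ratio_le`, i.e. by the MMS doubling `χ_{2N} ≤ (1 + (5d)ᵈ) χ_N` (ADC (5.21)). The
printed route ("by the Infrared Bound") is not needed for constants depending on `f`. [cite: AizenmanDuminilCopinAnnals2021, p. 6 (display after Prop. 1.4) and (5.21) (p. 16)] -/
theorem phi4_varianceBounds (hd : 1 ≤ d) {g : ℝ} (hg : 0 < g) (κ : ℝ)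
    (f : EuclideanSpace ℝ (Fin d) → ℝ) (hfc : Continuous f) (hfs : HasCompactSupport f) :
    (∃ C : ℝ, ∀ (J L : ℝ), 0 ≤ J → J ≤ phi4CriticalJ d g κ → 1 ≤ L →
        ∃ v : ℝ, HasBoxLimit (phi4BoxExpect d g κ J fun φ =>
          phi4NormalizedField d g κ J L f φ ^ 2) v ∧ v ≤ C) ∧
      ((∀ x, 0 ≤ f x) → f ≠ 0 → ∃ c L₀ : ℝ, 0 < c ∧
        ∀ (J L : ℝ), 0 ≤ J → J ≤ phi4CriticalJ d g κ → L₀ ≤ L →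
        ∃ v : ℝ, HasBoxLimit (phi4BoxExpect d g κ J fun φ =>
          phi4NormalizedField d g κ J L f φ ^ 2) v ∧ c ≤ v) := by
  obtain ⟨r, hr1, hfr⟩ := exists_cube_of_hasCompactSupport f hfs
  obtain ⟨Mf, hMf⟩ := hfc.bounded_above_of_compact_support hfs
  have hMf0 : 0 ≤ Mf := (norm_nonneg _).trans (hMf 0)
  -- notation-free abbreviations used in both halves
  have hB : ∀ {L : ℝ}, 0 < L → latticeBox d (r / |L⁻¹|) = box d ⌊r * L⌋₊ := by
    intro L hL
    rw [abs_inv, abs_of_pos hL, div_inv_eq_mul, latticeBox_eq_box (by positivity)]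
  have hSig : ∀ {J L : ℝ}, 0 ≤ J → 0 < L → phi4BlockVariance d g κ J L =
      ∑ x ∈ box d ⌊L⌋₊, ∑ y ∈ box d ⌊L⌋₊, ⨆ Λ : Finset (LSite d), phi4TwoPointIn d Λ g κ J x y :=
    fun hJ hL => phi4BlockVariance_eq_boxPairSum d hg κ hJ hL.le
  have hv : ∀ {J L : ℝ}, 0 ≤ J → 0 < L →
      HasBoxLimit (phi4BoxExpect d g κ J fun φ => phi4NormalizedField d g κ J L f φ ^ 2)
        ((∑ x ∈ box d ⌊r * L⌋₊, ∑ y ∈ box d ⌊r * L⌋₊, f (L⁻¹ • siteToE x) * f (L⁻¹ • siteToE y) *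
          ⨆ Λ : Finset (LSite d), phi4TwoPointIn d Λ g κ J x y) / phi4BlockVariance d g κ J L) := by
    intro J L hJ hL
    have h := hasBoxLimit_phi4NormalizedField_sq d hg κ hJ hL.ne' hfr
    rw [hB hL, inv_pow, Real.sq_sqrt (phi4BlockVariance_pos d hg κ hJ hL.le).le, inv_mul_eq_div] at h
    exact h
  have hSnn : ∀ (J : ℝ), 0 ≤ J → ∀ x y : LSite d,
      0 ≤ ⨆ Λ : Finset (LSite d), phi4TwoPointIn d Λ g κ J x y :=
    fun J hJ x y => iSup_phi4TwoPointIn_nonneg d hg κ hJ x y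
  constructor
  · -- the upper bound
    obtain ⟨C, hCpos, hC⟩ := boxPairSum_ratio_le d hd (ρ := 2 * r) (by linarith)
    refine ⟨Mf ^ 2 * C, fun J L hJ _ hL => ⟨_, hv hJ (by linarith), ?_⟩⟩
    have hL0 : 0 < L := by linarith
    set N : ℕ := ⌊L⌋₊ with hN
    set N' : ℕ := ⌊r * L⌋₊ with hN'
    have hSigpos : 0 < phi4BlockVariance d g κ J L := phi4BlockVariance_pos d hg κ hJ hL0.le
    have hN1 : 1 ≤ N := Nat.le_floor (by simpa using hL)
    have hNN' : (N' : ℝ) ≤ 2 * r * N := by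
      have h1 : (N' : ℝ) ≤ r * L := Nat.floor_le (by positivity)
      have h2 : L < N + 1 := Nat.lt_floor_add_one L
      have h3 : (1 : ℝ) ≤ N := by exact_mod_cast hN1
      nlinarith
    have hA := hC hg κ hJ N N' hN1 hNN'
    have hsum : ∑ x ∈ box d N', ∑ y ∈ box d N', f (L⁻¹ • siteToE x) * f (L⁻¹ • siteToE y) *
        (⨆ Λ : Finset (LSite d), phi4TwoPointIn d Λ g κ J x y) ≤
        Mf ^ 2 * ∑ x ∈ box d N', ∑ y ∈ box d N', ⨆ Λ : Finset (LSite d), phi4TwoPointIn d Λ g κ J x y := by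
      rw [Finset.mul_sum]
      refine Finset.sum_le_sum fun x _ => ?_
      rw [Finset.mul_sum]
      refine Finset.sum_le_sum fun y _ => ?_
      have h1 := abs_le.1 ((Real.norm_eq_abs _).symm.trans_le (hMf (L⁻¹ • siteToE x)))
      have h2 := abs_le.1 ((Real.norm_eq_abs _).symm.trans_le (hMf (L⁻¹ • siteToE y)))
      have hS := hSnn J hJ x y
      have hff : f (L⁻¹ • siteToE x) * f (L⁻¹ • siteToE y) ≤ Mf ^ 2 := by
        nlinarith
      exact mul_le_mul_of_nonneg_right hff hS
    rw [div_le_iff₀ hSigpos, hSig hJ hL0]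
    calc _ ≤ Mf ^ 2 * ∑ x ∈ box d N', ∑ y ∈ box d N', ⨆ Λ : Finset (LSite d), phi4TwoPointIn d Λ g κ J x y := hsum
      _ ≤ Mf ^ 2 * (C * ∑ x ∈ box d N, ∑ y ∈ box d N, ⨆ Λ : Finset (LSite d), phi4TwoPointIn d Λ g κ J x y) :=
          mul_le_mul_of_nonneg_left hA (sq_nonneg _)
      _ = _ := by ring
  · -- the lower bound
    intro hf0 hfne
    obtain ⟨x₀, hx₀⟩ : ∃ x₀, f x₀ ≠ 0 := Function.ne_iff.1 hfne
    have hfx₀ : 0 < f x₀ := lt_of_le_of_ne (hf0 x₀) (Ne.symm hx₀)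
    obtain ⟨δ, hδ, hball⟩ := exists_ball_gt_half d hfc hfx₀
    set ε : ℝ := f x₀ / 2 with hε
    have hεpos : 0 < ε := by rw [hε]; linarith
    have hd0 : (0 : ℝ) < d := by exact_mod_cast hd
    set ρ' : ℝ := max 1 (8 * d / δ) with hρ'
    obtain ⟨C', hC'pos, hC'⟩ := boxPairSum_ratio_le d hd (ρ := ρ') (le_max_left _ _)
    refine ⟨ε ^ 2 / C', 8 * d / δ, by positivity, fun J L hJ _ hL => ?_⟩
    have h8 : 8 * d / δ ≤ L := hL
    have hL0 : 0 < L := lt_of_lt_of_le (by positivity) h8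
    refine ⟨_, hv hJ hL0, ?_⟩
    set N : ℕ := ⌊L⌋₊ with hN
    set M : ℕ := ⌊δ * L / (4 * d)⌋₊ with hM
    set c : LSite d := fun i => ⌊L * x₀ i⌋ with hc
    have hSigpos : 0 < phi4BlockVariance d g κ J L := phi4BlockVariance_pos d hg κ hJ hL0.le
    -- sizes
    have hδL : 2 ≤ δ * L / (4 * d) := by
      rw [le_div_iff₀ (by positivity)]
      rw [div_le_iff₀ hδ] at h8
      nlinarith
    have hM2 : (M : ℝ) ≥ δ * L / (4 * d) - 1 := by
      have := Nat.lt_floor_add_one (δ * L / (4 * d))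
      rw [← hM] at this
      linarith
    have hMle : (M : ℝ) ≤ δ * L / (4 * d) := Nat.floor_le (by positivity)
    have hM1 : 1 ≤ M := by
      have : (1 : ℝ) ≤ M := by linarith
      exact_mod_cast this
    have hNM : (N : ℝ) ≤ ρ' * M := by
      have h1 : (N : ℝ) ≤ L := Nat.floor_le hL0.le
      have h2 : L ≤ 8 * d / δ * M := by
        rw [div_mul_eq_mul_div, le_div_iff₀ hδ]
        have : δ * L / (4 * d) * (4 * d) = δ * L := by field_simp
        nlinarith [hM2, this, hδL]
      calc (N : ℝ) ≤ L := h1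
        _ ≤ 8 * d / δ * M := h2
        _ ≤ ρ' * M := mul_le_mul_of_nonneg_right (le_max_right _ _) (Nat.cast_nonneg M)
    have hA := hC' hg κ hJ M N hM1 hNM
    -- the shifted box `c + Λ_M` lies in `{f(·/L) > ε}` and in the support box
    have hfar : ∀ z ∈ box d M, ε < f (L⁻¹ • siteToE (c + z)) := by
      intro z hz
      refine hball _ ((dist_latticePoint_le d hL0 x₀ hz).trans_lt ?_)
      rw [div_lt_iff₀ hL0]
      have h1 : (d : ℝ) * (M + 1) ≤ d * (δ * L / (4 * d)) + d := by nlinarith [hMle, hd0]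
      have h2 : (d : ℝ) * (δ * L / (4 * d)) = δ * L / 4 := by field_simp
      rw [div_le_iff₀ hδ] at h8
      nlinarith [h1, h2, h8]
    have hmemB : ∀ z ∈ box d M, c + z ∈ box d ⌊r * L⌋₊ := by
      intro z hz
      have hne : f (L⁻¹ • siteToE (c + z)) ≠ 0 := (hεpos.trans (hfar z hz)).ne'
      rw [← hB hL0, mem_latticeBox]
      intro i
      have h := hfr _ hne i
      rw [PiLp.smul_apply, siteToE_apply, smul_eq_mul, abs_mul] at h
      rw [le_div_iff₀ (abs_pos.2 (inv_ne_zero hL0.ne')), mul_comm]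
      exact h
    -- restrict the double sum to the shifted box
    have hrestrict : ε ^ 2 * ∑ x ∈ box d M, ∑ y ∈ box d M,
        (⨆ Λ : Finset (LSite d), phi4TwoPointIn d Λ g κ J x y) ≤
        ∑ x ∈ box d ⌊r * L⌋₊, ∑ y ∈ box d ⌊r * L⌋₊, f (L⁻¹ • siteToE x) * f (L⁻¹ • siteToE y) *
          ⨆ Λ : Finset (LSite d), phi4TwoPointIn d Λ g κ J x y := by
      have hterm_nn : ∀ x y : LSite d, 0 ≤ f (L⁻¹ • siteToE x) * f (L⁻¹ • siteToE y) *
          ⨆ Λ : Finset (LSite d), phi4TwoPointIn d Λ g κ J x y :=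
        fun x y => mul_nonneg (mul_nonneg (hf0 _) (hf0 _)) (hSnn J hJ x y)
      -- translation: the double sum over `c + Λ_M`
      have hshift : ∑ x ∈ box d M, ∑ y ∈ box d M,
          (⨆ Λ : Finset (LSite d), phi4TwoPointIn d Λ g κ J x y) =
          ∑ x ∈ (box d M).image (fun z => c + z), ∑ y ∈ (box d M).image (fun z => c + z),
            ⨆ Λ : Finset (LSite d), phi4TwoPointIn d Λ g κ J x y := by
        rw [Finset.sum_image (fun z _ z' _ h => add_left_cancel h)]
        refine Finset.sum_congr rfl fun z _ => ?_
        rw [Finset.sum_image (fun w _ w' _ h => add_left_cancel h)]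
        refine Finset.sum_congr rfl fun w _ => ?_
        have h := iSup_phi4TwoPointIn_shift d c g κ J z w
        rw [add_comm z c, add_comm w c] at h
        exact h.symm
      have himg : (box d M).image (fun z => c + z) ⊆ box d ⌊r * L⌋₊ := by
        intro x hx
        obtain ⟨z, hz, rfl⟩ := Finset.mem_image.1 hx
        exact hmemB z hz
      calc ε ^ 2 * ∑ x ∈ box d M, ∑ y ∈ box d M, (⨆ Λ : Finset (LSite d), phi4TwoPointIn d Λ g κ J x y)
          = ∑ x ∈ (box d M).image (fun z => c + z), ∑ y ∈ (box d M).image (fun z => c + z),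
              ε ^ 2 * ⨆ Λ : Finset (LSite d), phi4TwoPointIn d Λ g κ J x y := by
            rw [hshift, Finset.mul_sum]
            refine Finset.sum_congr rfl fun x _ => ?_
            rw [Finset.mul_sum]
        _ ≤ ∑ x ∈ (box d M).image (fun z => c + z), ∑ y ∈ (box d M).image (fun z => c + z),
              f (L⁻¹ • siteToE x) * f (L⁻¹ • siteToE y) *
                ⨆ Λ : Finset (LSite d), phi4TwoPointIn d Λ g κ J x y := by
            refine Finset.sum_le_sum fun x hx => Finset.sum_le_sum fun y hy => ?_
            obtain ⟨z, hz, rfl⟩ := Finset.mem_image.1 hx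
            obtain ⟨w, hw, rfl⟩ := Finset.mem_image.1 hy
            have h1 := hfar z hz
            have h2 := hfar w hw
            refine mul_le_mul_of_nonneg_right ?_ (hSnn J hJ _ _)
            nlinarith [hεpos]
        _ ≤ ∑ x ∈ box d ⌊r * L⌋₊, ∑ y ∈ (box d M).image (fun z => c + z),
              f (L⁻¹ • siteToE x) * f (L⁻¹ • siteToE y) *
                ⨆ Λ : Finset (LSite d), phi4TwoPointIn d Λ g κ J x y :=
            Finset.sum_le_sum_of_subset_of_nonneg himg fun x _ _ =>
              Finset.sum_nonneg fun y _ => hterm_nn x y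
        _ ≤ _ := Finset.sum_le_sum fun x _ =>
            Finset.sum_le_sum_of_subset_of_nonneg himg fun y _ _ => hterm_nn x y
    -- conclude
    rw [le_div_iff₀ hSigpos, hSig hJ hL0]
    have hAM : 0 ≤ ∑ x ∈ box d M, ∑ y ∈ box d M,
        (⨆ Λ : Finset (LSite d), phi4TwoPointIn d Λ g κ J x y) :=
      Finset.sum_nonneg fun x _ => Finset.sum_nonneg fun y _ => hSnn J hJ x y
    calc ε ^ 2 / C' * ∑ x ∈ box d N, ∑ y ∈ box d N, (⨆ Λ : Finset (LSite d), phi4TwoPointIn d Λ g κ J x y)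
        ≤ ε ^ 2 / C' * (C' * ∑ x ∈ box d M, ∑ y ∈ box d M,
            ⨆ Λ : Finset (LSite d), phi4TwoPointIn d Λ g κ J x y) :=
          mul_le_mul_of_nonneg_left hA (by positivity)
      _ = ε ^ 2 * ∑ x ∈ box d M, ∑ y ∈ box d M,
            (⨆ Λ : Finset (LSite d), phi4TwoPointIn d Λ g κ J x y) := by
          field_simp
      _ ≤ _ := hrestrict

/-- **`phi44_triviality` (Aizenman–Duminil-Copin 2021, Thm 1.2 for lattice `φ⁴₄`) follows from
Prop. 7.2 alone.** The variance-bounds hypothesis `hvar` of `phi44_triviality_of_prop72` being a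
theorem (`phi4_varianceBounds`), the tree's named fact `phi44_triviality` is reduced to the single
printed estimate `h72` — ADC Prop. 7.2 (p. 28) for the free-boundary infinite-volume lattice `φ⁴`
state on `ℤ⁴` inside the window `L ≤ ξ`, in the form its proof establishes. [cite: AizenmanDuminilCopinAnnals2021, Thm 1.2 (p. 4), Prop. 7.2 (p. 28), p. 6] -/
theorem phi44_triviality_of_prop72'
    (h72 : ∀ (g κ : ℝ), 0 < g → ∃ c C : ℝ, 0 < c ∧ 0 < C ∧
      ∀ (J L r : ℝ), 0 ≤ J → J ≤ phi4CriticalJ 4 g κ →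
        (J = phi4CriticalJ 4 g κ ∨ (0 < J ∧ L * invCorrLength (phi4TwoPoint 4 g κ J) ≤ 1)) →
        1 < L → 1 ≤ r →
      ∀ f : EuclideanSpace ℝ (Fin 4) → ℝ, Continuous f → (∀ x, f x ≠ 0 → ∀ i, |x i| ≤ r) →
      ∀ z : ℝ, ∃ m v v' : ℝ,
        HasBoxLimit (phi4BoxExpect 4 g κ J fun φ =>
          Real.exp (z * phi4NormalizedField 4 g κ J L f φ)) m ∧
        HasBoxLimit (phi4BoxExpect 4 g κ J fun φ => phi4NormalizedField 4 g κ J L f φ ^ 2) v ∧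
        HasBoxLimit (phi4BoxExpect 4 g κ J fun φ =>
          phi4NormalizedField 4 g κ J L (fun x => |f x|) φ ^ 2) v' ∧
        |m - Real.exp (z ^ 2 / 2 * v)| ≤
          Real.exp (z ^ 2 / 2 * v') * (C * (⨆ x, |f x|) ^ 4 * r ^ 12 * z ^ 4 / Real.log L ^ c)) :
    phi44_triviality :=
  phi44_triviality_of_prop72 h72 fun g κ hg f hf hfs => phi4_varianceBounds 4 (by norm_num) hg κ f hf hfs

end VarianceBounds

end Literature.MathematicalPhysics.QuantumFieldTheory
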